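import Literature.AlgebraicGeometry.Resolution.AlterationsSemiStableThickness
import HarnessLib

/-!
# The singular scheme `Sing(f)` of a semi-stable curve: two inputs (de Jong 1996, 2.21, 3.1; Stacks 01V9, 0C59)

Topic: `Literature/AlgebraicGeometry/Resolution`. Third layer of the decomposition of de Jong
1996, Lemma 3.2, below `AlterationsSemiStableThickness.lean`, which left the named fact
`DeJong1996SemiStableThickness` (3.4: "The integer `n_T` must be `≥ 2` … it is an invariant
`n_T`", rendered: at a non-regular point `x` with `dim 𝒪_{X,x} ≤ 2` of the curve `f : X → Y` of
a pair in Situation 4.23, the local ring `𝒪_{X,x}/Fitt₁(Ω_{X/Y})_x` of the singular scheme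
`Sing(f)` (2.21) has finite length `≥ 2`). The printed argument (2.21, 2.23, 3.1, 3.3) rests on
three properties of `Sing(f) = V(Fitt₁ Ω_{X/S})` for a semi-stable curve `f : X → S`, two of
which are vendored here as NAMED FACTS at the level of the stalks `𝒪_{S,s} → 𝒪_{X,x}`
(`s = f x`), in which form `AlterationsSemiStableThicknessProofs.lean` assembles
`DeJong1996SemiStableThickness` from them and from the third:

* `DeJong1996SingUnramified` — **2.21: "The morphism `Sing(f) → S` is finite, unramified and
  of finite presentation"**, the clause *unramified*, stalkwise (Stacks 00UW/02FM: a local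
  homomorphism essentially of finite type `𝒪_{S,s} → 𝒪_{Z,x}` is unramified iff
  `𝔪_s 𝒪_{Z,x} = 𝔪_{Z,x}` and `κ(x)/κ(s)` is separable algebraic), with
  `𝒪_{Z,x} = 𝒪_{X,x}/Fitt₁`: for `x ∈ Sing(f)`, `𝔪_x ⊆ Fitt₁(Ω)_x + 𝔪_s 𝒪_{X,x}` and `κ(x)/κ(s)`
  is separable (also Stacks 0C59: "`Sing(f)` … is unramified over `S`");
* `DeJong1996SmoothIffDifferentialsCyclic` — **the smooth locus of `f` is the complement of
  `Sing(f)`** (3.1: "`f : X → S` smooth over `S ∖ D` … the singular locus `Sing(X)` of the scheme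
  `X` is contained in `Sing(f)`"; 3.3: "By assumption we have `V(h) ⊂ V(t₁ ⋯ t_r)`"), in the
  form of the differential criterion Stacks 01V9 (1) ⇔ (3): "`f` is smooth at `x`" iff
  "`𝒪_{S,s} → 𝒪_{X,x}` is flat and the `𝒪_{X,x}`-module `Ω_{X/S,x}` can be generated by at most
  `dim_x(X_{f(x)})` elements" — here `f` is flat and every fibre of a semi-stable curve is a
  curve (2.21), `dim_x(X_s) = 1`: `f` is smooth on a neighbourhood of `x` iff `Ω_{X/S,x}` is
  cyclic (equivalently, over the local ring `𝒪_{X,x}`, iff `Fitt₁(Ω)_x = 𝒪_{X,x}`, Stacks 07ZC,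
  `Literature.RingTheory.FittingIdeal.Module.fittingIdeal_one_eq_top_iff`);
* the third — **2.23, Remark: "the trace of `Sing(f)` on the scheme `Spec B` is given by the
  ideal `(u, v) ⊂ B`"** (`B = 𝒪̂_{X,x}`, `S` Noetherian, `x ∈ Sing(f)`; `B ≅ A'⟦u, v⟧/(Q - h)`
  with `h ∈ A'`), whence, `𝒪_{X,x} → 𝒪̂_{X,x}` being faithfully flat, `Fitt₁(Ω_{X/S})_x` is
  generated by two elements of `𝒪_{X,x}` — is NOT vendored here. In the printed generality (any
  semi-stable curve over a Noetherian base, any point of `Sing(f)`, where `κ(s) ⊂ κ(x)` is only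
  finite separable) it needs the non-split local description of 2.23 (the finite étale
  extension `A → A'` and the quadratic form `Q`), which the tree does not have; the assembly
  consumes it only at the non-regular points of the curve of a PAIR in Situation 4.23 over an
  algebraically closed field, where it is PROVED
  (`DeJong1996.SemiStablePair.exists_singFittingIdeal_eq_span_pair`,
  `AlterationsSemiStableThicknessHolds.lean`: the split formal structure of 2.23 with its Remark
  at a closed point `x₀ ∈ cl{x}` of `Sing(f)`, descent of two generators along
  `𝒪_{X,x₀} → 𝒪̂_{X,x₀}`, localization to `x`), so the assembly takes it as an explicit
  hypothesis of that shape. (It was at first vendored here as a third named fact in the printed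
  generality; the split review of that fact, D-0026, merged it back into the assembly.)

Both facts are discharged: `DeJong1996SingUnramified_holds` (`AlterationsSingFittingProofs.lean`,
from Stacks 0C4D, the Fitting ideal of a node of the fibre, and 0C3I) and
`DeJong1996SmoothIffDifferentialsCyclic_holds` (`AlterationsSingFittingSmoothProofs.lean`, 01V9
with the fibre dimension); so is `DeJong1996SemiStableThickness`
(`DeJong1996SemiStableThickness_holds`, `AlterationsSemiStableThicknessHolds.lean`).

## Sources

* A. J. de Jong, *Smoothness, semi-stability and alterations*, Publ. Math. IHÉS 83 (1996),
  2.21, 2.23 (pp. 61–62), 3.1, 3.3 (pp. 62–63).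
* The Stacks Project, Tags 00UW, 02FM (unramified local homomorphisms), 01V9 (smoothness at a
  point via `Ω_{X/S,x}`), 07ZC (Fitting ideals at a prime), 0C3K (`V(Fitt_d Ω_{X/S})` is the
  non-smooth locus), 0C4D (nodes via `Fitt₁`), 0C59 (`Sing(f) → S` unramified for nodal
  families), 0CBX (formal local structure of a nodal family).
-/

noncomputable section

open CategoryTheory CategoryTheory.Limits AlgebraicGeometry TopologicalSpace IsLocalRing

namespace Literature.AlgebraicGeometry.Resolution

universe u

/-- NAMED FACT — **de Jong 1996, 2.21: `Sing(f) → S` is unramified.** "Let `S` be a scheme. A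
semi-stable curve `X` over `S` is a flat proper `f : X → S` of finite presentation, such that all
geometric fibres are connected curves having at most ordinary double points as singularities.
Let `Sing(f) ⊂ X` be the closed subscheme defined by the first Fitting ideal of the sheaf
`Ω_{X/S}`. The morphism `Sing(f) → S` is finite, unramified and of finite presentation." (Also
The Stacks Project, Tag 0C59 (1) ⇒ (2): "the closed subscheme `Sing(f) ⊂ X` defined by the first
Fitting ideal of `Ω_{X/S}` is unramified over `S`".) Rendered: the clause UNRAMIFIED, at the
stalks — by Stacks 00UW/02FM a local homomorphism essentially of finite type
`𝒪_{S,s} → 𝒪_{Z,x}` is unramified iff `𝔪_s 𝒪_{Z,x} = 𝔪_{Z,x}` and `κ(x) ⊇ κ(s)` is separable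
algebraic — for the local rings `𝒪_{Z,x} = 𝒪_{X,x}/Fitt₁(Ω_{X/S})_x`
(`Scheme.Hom.singFittingIdeal`) of `Z = Sing(f)` at its points `x` (those with `Fitt₁ ≠ 𝒪_{X,x}`),
`s = f x`: `𝔪_x ⊆ Fitt₁(Ω_{X/S})_x + 𝔪_s 𝒪_{X,x}`, and `κ(x)/κ(s)` is separable (2.23: "The
extension `κ(s) ⊂ κ(x)` is finite separable, as `Sing(f) → S` is finite unramified"). The
clauses "finite" and "of finite presentation" are not rendered. Users take
`(h : DeJong1996SingUnramified)`; it is a node to discharge (Stacks 0C4D (1) ⇒ (4): at a node of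
the fibre `X_s` the first Fitting ideal of `Ω_{X_s/κ(s)}` generates `𝔪_x`, and 0C3I: its
formation commutes with base change). [cite: DeJong1996, 2.21, p. 61] -/
def DeJong1996SingUnramified : Prop :=
  ∀ (X S : Scheme.{u}) (f : X ⟶ S), IsSemiStableCurve f → ∀ x : X,
    Scheme.Hom.singFittingIdeal f x ≠ ⊤ →
      maximalIdeal (X.presheaf.stalk x) ≤
          Scheme.Hom.singFittingIdeal f x ⊔
            (maximalIdeal (S.presheaf.stalk (f x))).map (f.stalkMap x).hom ∧
        (letI : Algebra (S.residueField (f x)) (X.residueField x) :=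
            (f.residueFieldMap x).hom.toAlgebra;
          Algebra.IsSeparable (S.residueField (f x)) (X.residueField x))

/-- NAMED FACT — **the smooth locus of a semi-stable curve is the complement of `Sing(f)`**
(de Jong 1996, 3.1: "Assume we have a semi-stable curve `f : X → S` smooth over `S ∖ D`. We remark
that the singular locus `Sing(X)` of the scheme `X` is contained in `Sing(f)`"; 3.3: "The
singular locus of `f` traced on `Spec B` maps isomorphically to the closed subscheme
`V(h) ⊂ Spec A'`. By assumption we have `V(h) ⊂ V(t₁ · … · t_r)`"), in the form of the
differential criterion of smoothness at a point, The Stacks Project, Tag 01V9: "Let `f : X → S`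
be a morphism of schemes. Let `x ∈ X`. Set `s = f(x)`. Assume `f` is locally of finite
presentation. The following are equivalent: (1) The morphism `f` is smooth at `x`. … (3) The
local ring map `𝒪_{S,s} → 𝒪_{X,x}` is flat and the `𝒪_{X,x}`-module `Ω_{X/S,x}` can be generated
by at most `dim_x(X_{f(x)})` elements." For a semi-stable curve `f` (2.21: flat, of finite
presentation, all fibres curves, so `dim_x(X_s) = 1` at every `x`; and
`Ω_{X/S,x} = Ω_{𝒪_{X,x}/𝒪_{S,s}}`, Kähler differentials commuting with localization): `f` is
smooth on an open neighbourhood of `x` iff the `𝒪_{X,x}`-module `Ω_{𝒪_{X,x}/𝒪_{S, f x}}` is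
generated by one element — equivalently (Stacks 07ZC over the local ring `𝒪_{X,x}`,
`Literature.RingTheory.FittingIdeal.Module.fittingIdeal_one_eq_top_iff`) iff
`Fitt₁(Ω_{X/S})_x = 𝒪_{X,x}`, i.e. `x ∉ Sing(f)` (Stacks 0C3K with `d = 1`). Users take
`(h : DeJong1996SmoothIffDifferentialsCyclic)`; it is a node to discharge (01V9 and the fibre
dimension of 2.21). [cite: StacksProject, Tag 01V9] -/
def DeJong1996SmoothIffDifferentialsCyclic : Prop :=
  ∀ (X S : Scheme.{u}) (f : X ⟶ S), IsSemiStableCurve f → ∀ x : X,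
    (∃ U : X.Opens, x ∈ U ∧ Smooth (U.ι ≫ f)) ↔
      letI : Algebra (S.presheaf.stalk (f x)) (X.presheaf.stalk x) :=
        (f.stalkMap x).hom.toAlgebra;
      ∃ ω : KaehlerDifferential (S.presheaf.stalk (f x)) (X.presheaf.stalk x),
        Submodule.span (X.presheaf.stalk x) {ω} = ⊤

end Literature.AlgebraicGeometry.Resolution

end
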